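import Literature.IUT.LogVolume.Corollary22TwoAdicIntegrality
import Literature.NumberTheory.DiophantineGeometry.FibreConductorSummation
import HarnessLib

/-!
# Bad places: `p`-adic separation of a point from the zeros of a form bounds `Σ_{w∣p} ord⁺_w·log N(w)`

Companion of `FibreConductorSummation.lean` (abc-iut cell, route item GenEllTwo = ledger
`stmt-ABC-19679`; work package W5 "sharp Prop. 1.6 on the curve", piece W5d; [GenEll] =
S. Mochizuki, *Arithmetic elliptic curves in general position*, Math. J. Okayama Univ. **52** (2010),
Thm. 2.1, proof pp. 12–13).  The summation theorem there (`sum_logNorm_le_of_good_bad`) leaves, at the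
finitely many BAD places `Sbad`, the two terms `Σ_{w ∈ Sbad} ord⁺_w(a)·log N(w)` and `Σ_{w ∈ Sbad} log N(w)`
to be bounded by a constant times `[L:ℚ]`.  Compactly bounded subsets ([GenEll] Ex. 1.3 (ii); the
cell's `GenEll.CBData`) speak about EMBEDDINGS `σ : L → ℚ̄_p` (Mathlib `PadicAlgCl p`), and separation
of the point from the zero locus of the form at `p` delivers a UNIFORM lower bound `‖σ(a)‖ ≥ p^{−k}`
for every such `σ`.  This file converts that into the bound on the places over `p` — with NO
embeddings-versus-places dictionary, by the minimal-polynomial trick of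
`Literature.IUT.LogVolume.Cor22.valuation_le_one_of_forall_norm_embedding_le_one` (abc-iut-S3,
`Corollary22TwoAdicIntegrality.lean`, there for `p = 2` and the `j`-invariant):

* `sum_placesOver_toNat_ord_mul_logNorm_le` — `(∀ σ, p^{−k} ≤ ‖σ a‖) ⟹
  Σ_{w ∣ p} ord⁺_w(a)·log N(w) ≤ [L:ℚ]·k·log p`;
* `sum_placesOver_logNorm_le` — `Σ_{w ∣ p} log N(w) ≤ [L:ℚ]·log p` (the trivial bound on the
  conductor above `p`, `Σ_{w∣p} e_w f_w = [L:ℚ]`);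
* `exists_pow_inv_le` — any separation constant `c > 0` is `≥ p^{−k}` for some `k`;
* `posLog_infinitePlace_inv_le_of_forall_embedding` — an archimedean separation `δ ≤ ‖σ a‖` at every
  complex embedding gives `log⁺|a⁻¹|_v ≤ log⁺ δ⁻¹` at every infinite place;
* **`inv_finrank_mul_sum_logNorm_le`** — the END-TO-END normalised statement the GenEllTwo assembly
  (W9) instantiates at `a := N(P)`, `τ_b := T_b(P)`: sharp multiplicity inequalities at the good places
  + per-embedding archimedean and `p`-adic (for `p` in the finite bad set `S`) lower bounds on `|σ(a)|`
  ⟹ `(1/[L:ℚ])·Σ_{w ∈ W} log N(w) ≤ Σ_b h(τ_b) − h(a) + log⁺ δ⁻¹ + Σ_{p ∈ S} (k_p + 1)·log p`,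
  `h := logHeight₁/[L:ℚ]`; every constant on the right is independent of the point and of `L`.

Classical valuation bookkeeping; no new definitions; nothing here refers to the disputed parts of the
abc-iut corpus. [cite: MochizukiGenEll2010, Thm 2.1 proof pp.12-13] [cite: BombieriGubler2006, §1.5]
-/

noncomputable section

open NumberField IsDedekindDomain Height Real Finset
open Literature.IUT.LogVolume Literature.IUT.LogVolume.Cor22

namespace Literature.NumberTheory.DiophantineGeometry.FibreConductor

variable {L : Type*} [Field L] [NumberField L]

/-- `‖p‖ = p⁻¹` in `ℚ̄_p` (plumbing). [folklore] -/
private theorem norm_natCast_padicAlgCl (p : ℕ) [Fact p.Prime] : ‖(p : PadicAlgCl p)‖ = (p : ℝ)⁻¹ := by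
  have h : (p : PadicAlgCl p) = ((p : ℚ_[p]) : PadicAlgCl p) := (map_natCast _ p).symm
  rw [h, PadicAlgCl.norm_extends, Padic.norm_p]

/-- Any positive separation constant `c > 0` dominates some `p^{−k}` — so a compactness constant at the
place `p` ([GenEll] Thm 2.1 proof, p. 13: the bounding domains are compact) can be fed to the lemmas
below. [cite: MochizukiGenEll2010, Thm 2.1 proof pp.12-13] -/
theorem exists_pow_inv_le (p : ℕ) [hp : Fact p.Prime] {c : ℝ} (hc : 0 < c) :
    ∃ k : ℕ, ((p : ℝ) ^ k)⁻¹ ≤ c := by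
  have hp1 : (1 : ℝ) < p := by exact_mod_cast hp.out.one_lt
  obtain ⟨k, hk⟩ := pow_unbounded_of_one_lt c⁻¹ hp1
  exact ⟨k, by rw [inv_le_comm₀ (by positivity) hc]; exact hk.le⟩

omit [NumberField L] in
/-- Separation ⇒ integrality of `p^k·a⁻¹` at every `p`-adic embedding: if `p^{−k} ≤ ‖σ a‖` for all
`σ : L → ℚ̄_p`, then `‖σ(p^k·a⁻¹)‖ ≤ 1` for all `σ`. [cite: MochizukiGenEll2010, Thm 2.1 proof pp.12-13] -/
theorem norm_embedding_pow_mul_inv_le_one (p : ℕ) [hp : Fact p.Prime] {a : L} (k : ℕ)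
    (h : ∀ σ : L →+* PadicAlgCl p, ((p : ℝ) ^ k)⁻¹ ≤ ‖σ a‖) (σ : L →+* PadicAlgCl p) :
    ‖σ ((p : L) ^ k * a⁻¹)‖ ≤ 1 := by
  have hpk : (0 : ℝ) < (p : ℝ) ^ k := by
    have : (0 : ℝ) < p := by exact_mod_cast hp.out.pos
    positivity
  by_cases ha : a = 0
  · simp [ha]
  have hσa : 0 < ‖σ a‖ := norm_pos_iff.mpr ((map_ne_zero σ).mpr ha)
  rw [map_mul, map_pow, map_natCast, map_inv₀, norm_mul, norm_pow, norm_inv,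
    norm_natCast_padicAlgCl, inv_pow, ← div_eq_mul_inv, div_le_one hσa]
  exact h σ

/-- At a place `w ∣ p`: if `p^k·a⁻¹` is `w`-integral then `ord⁺_w(a) ≤ k·e_w` (`ord_w(p) = e_w`).
[cite: MochizukiGenEll2010, Thm 2.1 proof pp.12-13] -/
theorem toNat_ord_le_of_valuation_pow_mul_inv_le_one (p : ℕ) [hp : Fact p.Prime] {a : L}
    (ha : a ≠ 0) (k : ℕ) (w : HeightOneSpectrum (𝓞 L)) (hw : w ∈ placesOver L p)
    (h : w.valuation L ((p : L) ^ k * a⁻¹) ≤ 1) : (ord L w a).toNat ≤ k * ramIdx L w := by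
  have hp0 : (p : L) ≠ 0 := by exact_mod_cast hp.out.ne_zero
  have hpk : (p : L) ^ k ≠ 0 := pow_ne_zero _ hp0
  have hord : 0 ≤ ord L w ((p : L) ^ k * a⁻¹) :=
    ord_nonneg_of_valuation_le_one w (mul_ne_zero hpk (inv_ne_zero ha)) h
  rw [ord_mul L w hpk (inv_ne_zero ha), ord_pow, ord_inv, ord_natCast_eq_ramIdx p w hw] at hord
  have hle : ord L w a ≤ k * ramIdx L w := by linarith
  have hnn : (0 : ℤ) ≤ k * ramIdx L w := by positivity
  omega

/-- **Separation at `p` bounds the `p`-part of the order of `a`.**  If `p^{−k} ≤ ‖σ a‖` for every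
embedding `σ : L → ℚ̄_p`, then `Σ_{w ∣ p} ord⁺_w(a)·log N(w) ≤ [L:ℚ]·(k·log p)`
(`ord⁺_w(a) ≤ k e_w`, `log N(w) = f_w log p`, `Σ_{w∣p} e_w f_w = [L:ℚ]`). This is the bad-place input
`hbad` of `FibreConductor.sum_logNorm_le_of_good_bad` in the currency of compactly bounded subsets.
[cite: MochizukiGenEll2010, Thm 2.1 proof pp.12-13] -/
theorem sum_placesOver_toNat_ord_mul_logNorm_le (p : ℕ) [hp : Fact p.Prime] {a : L} (ha : a ≠ 0)
    (k : ℕ) (h : ∀ σ : L →+* PadicAlgCl p, ((p : ℝ) ^ k)⁻¹ ≤ ‖σ a‖) :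
    ∑ w ∈ placesOver L p, ((ord L w a).toNat : ℝ) * logNorm L w ≤
      (Module.finrank ℚ L : ℝ) * (k * Real.log p) := by
  have hint := norm_embedding_pow_mul_inv_le_one p k h
  have hterm : ∀ w ∈ placesOver L p,
      ((ord L w a).toNat : ℝ) * logNorm L w ≤ (k * Real.log p) * (localDegree L w : ℝ) := by
    intro w hw
    have hres : residueChar L w = p := (mem_placesOver_iff_residueChar w).mp hw
    have hpw : ((p : ℕ) : 𝓞 L) ∈ w.asIdeal := by
      haveI h1 : w.asIdeal.LiesOver (Ideal.span {(p : ℤ)}) := (mem_placesOver_iff w).mp hw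
      have h2 : algebraMap ℤ (𝓞 L) (p : ℤ) ∈ w.asIdeal :=
        (Ideal.mem_of_liesOver w.asIdeal (Ideal.span {(p : ℤ)}) (p : ℤ)).mp
          (Ideal.mem_span_singleton_self _)
      simpa using h2
    have hval : w.valuation L ((p : L) ^ k * a⁻¹) ≤ 1 :=
      valuation_le_one_of_forall_norm_embedding_le_one p hint w hpw
    have hk : ((ord L w a).toNat : ℝ) ≤ k * (ramIdx L w : ℝ) := by
      exact_mod_cast toNat_ord_le_of_valuation_pow_mul_inv_le_one p ha k w hw hval
    have hln : logNorm L w = resDeg L w * Real.log p := by rw [logNorm_eq, hres]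
    have hlogp : 0 ≤ Real.log p := Real.log_nonneg (by exact_mod_cast hp.out.one_lt.le)
    rw [hln, localDegree, Nat.cast_mul]
    have hf : (0 : ℝ) ≤ resDeg L w * Real.log p := by positivity
    calc ((ord L w a).toNat : ℝ) * (resDeg L w * Real.log p)
        ≤ k * (ramIdx L w : ℝ) * (resDeg L w * Real.log p) := mul_le_mul_of_nonneg_right hk hf
      _ = k * Real.log p * ((ramIdx L w : ℝ) * resDeg L w) := by ring
  calc ∑ w ∈ placesOver L p, ((ord L w a).toNat : ℝ) * logNorm L w
      ≤ ∑ w ∈ placesOver L p, (k * Real.log p) * (localDegree L w : ℝ) := Finset.sum_le_sum hterm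
    _ = (k * Real.log p) * ∑ w ∈ placesOver L p, (localDegree L w : ℝ) := by rw [Finset.mul_sum]
    _ = (Module.finrank ℚ L : ℝ) * (k * Real.log p) := by
        rw [← Nat.cast_sum, sum_localDegree]; ring

/-- The trivial conductor bound above one rational prime: `Σ_{w ∣ p} log N(w) ≤ [L:ℚ]·log p`.
[cite: MochizukiGenEll2010, Thm 2.1 proof pp.12-13] -/
theorem sum_placesOver_logNorm_le (p : ℕ) [hp : Fact p.Prime] :
    ∑ w ∈ placesOver L p, logNorm L w ≤ (Module.finrank ℚ L : ℝ) * Real.log p := by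
  have hlogp : 0 ≤ Real.log p := Real.log_nonneg (by exact_mod_cast hp.out.one_lt.le)
  have hterm : ∀ w ∈ placesOver L p, logNorm L w ≤ Real.log p * (localDegree L w : ℝ) := by
    intro w hw
    have hres : residueChar L w = p := (mem_placesOver_iff_residueChar w).mp hw
    rw [logNorm_eq, hres, localDegree, Nat.cast_mul]
    have he : (1 : ℝ) ≤ ramIdx L w := by exact_mod_cast Nat.one_le_iff_ne_zero.mpr (ramIdx_ne_zero L w)
    have hf : (0 : ℝ) ≤ resDeg L w := Nat.cast_nonneg _
    nlinarith [mul_nonneg (mul_nonneg hf hlogp) (sub_nonneg.mpr he)]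
  calc ∑ w ∈ placesOver L p, logNorm L w
      ≤ ∑ w ∈ placesOver L p, Real.log p * (localDegree L w : ℝ) := Finset.sum_le_sum hterm
    _ = Real.log p * ∑ w ∈ placesOver L p, (localDegree L w : ℝ) := by rw [Finset.mul_sum]
    _ = (Module.finrank ℚ L : ℝ) * Real.log p := by rw [← Nat.cast_sum, sum_localDegree]; ring

open scoped Classical in
/-- Both bad-place terms at once, for a finite set `S` of rational primes and exponents `k p`:
if `p^{−k_p} ≤ ‖σ a‖` for all `p ∈ S` and all `σ : L → ℚ̄_p`, then, with
`Sbad := ⋃_{p ∈ S} {w ∣ p}` (a `Finset.biUnion`),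
`Σ_{w ∈ Sbad} ord⁺_w(a)·log N(w) + Σ_{w ∈ Sbad} log N(w) ≤ [L:ℚ]·Σ_{p∈S} (k_p + 1)·log p`.
[cite: MochizukiGenEll2010, Thm 2.1 proof pp.12-13] -/
theorem sum_biUnion_placesOver_le (S : Finset ℕ) (hS : ∀ p ∈ S, p.Prime) {a : L} (ha : a ≠ 0)
    (k : ℕ → ℕ)
    (h : ∀ p ∈ S, ∀ [Fact p.Prime], ∀ σ : L →+* PadicAlgCl p, ((p : ℝ) ^ k p)⁻¹ ≤ ‖σ a‖) :
    ∑ w ∈ S.attach.biUnion (fun p => placesOver L p.1),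
        ((ord L w a).toNat : ℝ) * logNorm L w +
      ∑ w ∈ S.attach.biUnion (fun p => placesOver L p.1), logNorm L w ≤
      (Module.finrank ℚ L : ℝ) * ∑ p ∈ S, ((k p : ℝ) + 1) * Real.log p := by
  -- the places over distinct rational primes are disjoint
  have hdisj : (↑S.attach : Set {p // p ∈ S}).PairwiseDisjoint (fun p => placesOver L p.1) := by
    intro p _ q _ hpq
    rw [Function.onFun, Finset.disjoint_left]
    intro w hwp hwq
    apply hpq
    haveI : Fact p.1.Prime := ⟨hS p.1 p.2⟩
    haveI : Fact q.1.Prime := ⟨hS q.1 q.2⟩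
    have e1 : residueChar L w = p.1 := (mem_placesOver_iff_residueChar w).mp hwp
    have e2 : residueChar L w = q.1 := (mem_placesOver_iff_residueChar w).mp hwq
    exact Subtype.ext (e1.symm.trans e2)
  rw [Finset.sum_biUnion hdisj, Finset.sum_biUnion hdisj, ← Finset.sum_add_distrib]
  have h3 : ∀ p ∈ S.attach,
      ∑ w ∈ placesOver L p.1, ((ord L w a).toNat : ℝ) * logNorm L w +
        ∑ w ∈ placesOver L p.1, logNorm L w ≤
      (Module.finrank ℚ L : ℝ) * (((k p.1 : ℝ) + 1) * Real.log p.1) := by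
    intro p _
    haveI : Fact p.1.Prime := ⟨hS p.1 p.2⟩
    have e1 := sum_placesOver_toNat_ord_mul_logNorm_le p.1 ha (k p.1) (h p.1 p.2)
    have e2 := sum_placesOver_logNorm_le (L := L) p.1
    nlinarith
  calc ∑ p ∈ S.attach, (∑ w ∈ placesOver L p.1, ((ord L w a).toNat : ℝ) * logNorm L w +
          ∑ w ∈ placesOver L p.1, logNorm L w)
      ≤ ∑ p ∈ S.attach, (Module.finrank ℚ L : ℝ) * (((k p.1 : ℝ) + 1) * Real.log p.1) :=
        Finset.sum_le_sum h3
    _ = (Module.finrank ℚ L : ℝ) * ∑ p ∈ S, ((k p : ℝ) + 1) * Real.log p := by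
        rw [← Finset.mul_sum, Finset.sum_attach S (fun p => ((k p : ℝ) + 1) * Real.log p)]

/-! ## Archimedean separation in embedding currency -/

omit [NumberField L] in
/-- An archimedean separation bound at every complex EMBEDDING, `δ ≤ ‖σ a‖`, gives
`log⁺|a⁻¹|_v ≤ log⁺ δ⁻¹` at every infinite PLACE (`|a|_v = ‖σ_v a‖`). [cite: MochizukiGenEll2010, Thm 2.1 proof pp.12-13] -/
theorem posLog_infinitePlace_inv_le_of_forall_embedding [NumberField L] {a : L} {δ : ℝ} (hδ : 0 < δ)
    (h : ∀ σ : L →+* ℂ, δ ≤ ‖σ a‖) (v : InfinitePlace L) : log⁺ (v a⁻¹) ≤ log⁺ δ⁻¹ := by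
  have hv : v a⁻¹ = ‖v.embedding a‖⁻¹ := by
    rw [map_inv₀, ← NumberField.InfinitePlace.apply, NumberField.InfinitePlace.mk_embedding]
  rw [hv]
  have hpos : 0 < ‖v.embedding a‖ := lt_of_lt_of_le hδ (h _)
  exact posLog_le_posLog (inv_nonneg.mpr hpos.le) ((inv_le_inv₀ hpos hδ).mpr (h _))

/-! ## The end-to-end normalised statement consumed by the GenEllTwo assembly -/

open scoped Classical in
/-- **Sharp conductor bound for a reduced fibre, global normalised form.**  Let `a : L` be non-zero,
`τ : ι → L` a finite family, `W` a finite set of finite places, `S` a finite set of rational primes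
(the bad primes) with exponents `k`, and `δ > 0`.  Suppose
(good places) at every `w ∈ W` off `S`: `1 + ord⁺_w(a) ≤ Σ_i ord⁺_w(τ_i)`, and at every `w ∉ W` off
`S`: `ord⁺_w(a) ≤ Σ_i ord⁺_w(τ_i)`;
(archimedean separation) `δ ≤ ‖σ a‖` for every `σ : L → ℂ`;
(`p`-adic separation) `p^{−k_p} ≤ ‖σ a‖` for every `p ∈ S` and every `σ : L → ℚ̄_p` (stated with the
instance binder `∀ [Fact p.Prime]`, the shape of `GenEll.CBData.Mem`).
Then, with `n := [L:ℚ]` and `h := logHeight₁/n`,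
`(1/n)·Σ_{w ∈ W} log N(w) ≤ Σ_i h(τ_i) − h(a) + log⁺ δ⁻¹ + Σ_{p ∈ S} (k_p + 1)·log p`.
In [GenEll] Thm 2.1's proof (sharp Prop. 1.6 for the reduced fibre `E = t⁻¹(B)` of the auxiliary map):
`a := N(P)` (ramification form), `τ_b := T_b(P)` (fibre forms), `W :=` the places where `t(P)` meets
`B`; the good-place inequalities are the local multiplicity count, the separations come from the
compactly bounded domain at `∞` and at the bad primes, and W4a turns the heights on the right into
`(|B|(e+3) − (3e+3))·h(x)/e + O(1)`. [cite: MochizukiGenEll2010, Thm 2.1 proof pp.12-13] -/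
theorem inv_finrank_mul_sum_logNorm_le {ι : Type*} [Fintype ι] {a : L} (ha : a ≠ 0) (τ : ι → L)
    (W : Finset (HeightOneSpectrum (𝓞 L))) (S : Finset ℕ) (hS : ∀ p ∈ S, p.Prime) (k : ℕ → ℕ)
    {δ : ℝ} (hδ : 0 < δ)
    (hmeet : ∀ w ∈ W, w ∉ S.attach.biUnion (fun p => placesOver L p.1) →
      1 + (ord L w a).toNat ≤ ∑ i, (ord L w (τ i)).toNat)
    (hoff : ∀ w, w ∉ W → w ∉ S.attach.biUnion (fun p => placesOver L p.1) →
      (ord L w a).toNat ≤ ∑ i, (ord L w (τ i)).toNat)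
    (harch : ∀ σ : L →+* ℂ, δ ≤ ‖σ a‖)
    (hbad : ∀ p ∈ S, ∀ [Fact p.Prime], ∀ σ : L →+* PadicAlgCl p, ((p : ℝ) ^ k p)⁻¹ ≤ ‖σ a‖) :
    (Module.finrank ℚ L : ℝ)⁻¹ * ∑ w ∈ W, logNorm L w ≤
      (∑ i, (Module.finrank ℚ L : ℝ)⁻¹ * logHeight₁ (τ i)) - (Module.finrank ℚ L : ℝ)⁻¹ * logHeight₁ a
        + log⁺ δ⁻¹ + ∑ p ∈ S, ((k p : ℝ) + 1) * Real.log p := by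
  set n : ℝ := (Module.finrank ℚ L : ℝ) with hn
  have hnpos : 0 < n := by rw [hn]; exact_mod_cast Module.finrank_pos
  set Sbad := S.attach.biUnion (fun p => placesOver L p.1) with hSbad
  -- archimedean term
  have hA : ∑ v : InfinitePlace L, (v.mult : ℝ) * log⁺ (v a⁻¹) ≤ n * log⁺ δ⁻¹ :=
    sum_mult_mul_posLog_inv_le_of_forall a (posLog_infinitePlace_inv_le_of_forall_embedding hδ harch)
  -- bad-place terms
  have hB := sum_biUnion_placesOver_le S hS ha k hbad
  -- the good/bad summation with `C := Σ_{Sbad} ord⁺·logNorm` itself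
  have hmain := sum_logNorm_le_of_good_bad a τ W Sbad (A := n * log⁺ δ⁻¹)
    (C := ∑ w ∈ Sbad, ((ord L w a).toNat : ℝ) * logNorm L w)
    (fun w hw hb => hmeet w hw hb) (fun w hw hb => hoff w hw hb) le_rfl hA
  -- collect, then divide by `n`
  rw [← hSbad] at hB
  have key : ∑ w ∈ W, logNorm L w ≤
      (∑ i, logHeight₁ (τ i)) - logHeight₁ a +
        n * (log⁺ δ⁻¹ + ∑ p ∈ S, ((k p : ℝ) + 1) * Real.log p) := by
    have hB' : ∑ w ∈ Sbad, ((ord L w a).toNat : ℝ) * logNorm L w + ∑ w ∈ Sbad, logNorm L w ≤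
        n * ∑ p ∈ S, ((k p : ℝ) + 1) * Real.log p := by rw [hn]; exact hB
    linarith
  have hne : n ≠ 0 := hnpos.ne'
  calc n⁻¹ * ∑ w ∈ W, logNorm L w
      ≤ n⁻¹ * ((∑ i, logHeight₁ (τ i)) - logHeight₁ a +
          n * (log⁺ δ⁻¹ + ∑ p ∈ S, ((k p : ℝ) + 1) * Real.log p)) :=
        mul_le_mul_of_nonneg_left key (inv_nonneg.mpr hnpos.le)
    _ = (∑ i, n⁻¹ * logHeight₁ (τ i)) - n⁻¹ * logHeight₁ a + log⁺ δ⁻¹ +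
          ∑ p ∈ S, ((k p : ℝ) + 1) * Real.log p := by
        have hc : n⁻¹ * (n * (log⁺ δ⁻¹ + ∑ p ∈ S, ((k p : ℝ) + 1) * Real.log p)) =
            log⁺ δ⁻¹ + ∑ p ∈ S, ((k p : ℝ) + 1) * Real.log p := by
          rw [← mul_assoc, inv_mul_cancel₀ hne, one_mul]
        rw [mul_add, hc, mul_sub, Finset.mul_sum]
        ring

end Literature.NumberTheory.DiophantineGeometry.FibreConductor
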